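import Summits.Ventures.CertifiedManyBodySolver.Observables.StiffnessThermalSectorGibbsBridge
import Summits.Ventures.CertifiedManyBodySolver.Observables.StiffnessTLOddMomentLocalObsTT
import Literature.MathematicalPhysics.QuantumLattice.TorusLimitOfMixturesLimsup
import Literature.MathematicalPhysics.QuantumLattice.FermionTorusTranslationSums
import HarnessLib

/-!
# The thermal kinetic hook from a TORUS-LIMIT bound: certificate-side glue for ROUTE T-A (`T_KT ≤ 1/β`)

HONEST FRAMING: a one-sided CEILING chain (kinetic energy ⇒ stiffness ⇒ `T_KT`); not a superconductivity verdict,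
not a `T_c` of any material, no number here. Cells `sr-mbsolver/hubbard-thermal` (seat p1: thermal certificate
objects + reader theorems) × `pub/hubbard-tc` (seat tc-mod-2: KT back-end). Companion of
`StiffnessThermalSectorGibbsBridge.lean` (p476253), which states the single-temperature stiffness leaf
`ObsThermalStiffnessSeqCeilingAtBeta t′ U n β c` from a `limsup` hypothesis on the MIXTURE average
`Σ_i p_{L,i}(β) Re⟨ψ_{L,i}, kinOpTT' L t′ ψ_{L,i}⟩/(2L²)` of the canonical Gibbs states. The thermal certificates
of hubbard-thermal (reader `HubbardTTPrimeThermalWindowCertificate*.lean`) bound instead `Re ω(k₀)` for EVERY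
TORUS LIMIT `ω` of those Gibbs states (`IsTorusLimitOfMixture` of the sector Gibbs data), `k₀ = kinBondObsTT t′`
the `x₁`-advancing kinetic bond observable (translation sum `= kinOpTT' L t′`). This file closes the gap:

* `sum_mul_re_expect_kinOp_eq_sq_mul_re_torusAvg` — at every side `L ≥ 3`, for every finite mixture,
  `Σ_i p_i Re⟨ψ_i, kinOpTT' L t′ ψ_i⟩ = L² · Re Σ_i p_i torusAvgExpect L [-1,1]² k₀ ψ_i` (translation sum);
* `ObsThermalStiffnessSeqCeilingAtBeta_of_torusLimit_kinetic_le` — if `Re ω(k₀) ≤ 2c` for every torus limit `ω`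
  of the canonical `(rectN n L, S^z = 0)` Gibbs states of `hubbardTorusTT' L 1 t′ U` at `β` (`0 ≤ n ≤ 2`), then the
  leaf holds with constant `c` (compactness + `limsup`: `eventually_re_sectorGibbsAvg_le_of_forall_torusLimit`,
  then the bridge's `…_of_sectorGibbsMixture_kinetic_eventually_add`; no margin is spent);
* `…_of_torusLimit_neg_kinetic_ge` — the same with the hypothesis in the READER'S OUTPUT SHAPE: a lower bound
  `−2c ≤ Re ω_{Λ'}(Xw)` for the objective `Xw = −Γ_{[-1,1]² ⊆ Λ'} k₀` in any certificate region `Λ' ⊇ [-1,1]²`;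
* closures `ThermalKTDictionaryAt.le_inv_of_torusLimit_kinetic_le` (`(π/4)c < 1/β ⇒ Tc ≤ 1/β`) and the row form
  `le_quarter_of_torusLimit_kinetic_le_four` (`(8, ⅞, 0)`, `β = 4`, `c < 0.3183098 ⇒ Tc ≤ 1/4`).

So an S3 row «`T_KT ≤ t/4` at `(8,⅞,0)`» is: a q = 0 thermal certificate at `β = 4` with objective `−Γk₀` and
certified constant `≥ −0.6366196`, read by `IsTorusLimitOfMixture.re_expect_ge_of_thermal_certificate_symm_TT'_of_sectorGibbs`,
fed to `le_quarter_of_torusLimit_neg_kinetic_ge_four`. Everything is PROVED; no definition, no named fact.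

WHAT THIS IS NOT: no certificate, no number, no `T_c`; pure glue between two landed interfaces.

References: ParamekantiTrivediRanderia1998 eq. (3), §IV; HazraVermaRanderia2019 eqs. (2)–(4); Bratteli–Robinson I
Thm. 2.3.15, §4.3.1; Israel1979 §I.3 eq. (26).
-/

noncomputable section

namespace Summit.Ventures.CertifiedManyBodySolver.Observables

open Filter Topology Matrix Finset
open Literature.MathematicalPhysics.QuantumLattice
open Literature.MathematicalPhysics.QuantumLattice.ThermodynamicLimit
open Literature.MathematicalPhysics.QuantumFieldTheory
open Literature.MathematicalPhysics.StatisticalMechanics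
open Literature.MathematicalPhysics.StatisticalMechanics.KosterlitzThouless
open Literature.Probability.LatticeModels
open scoped ComplexConjugate ComplexOrder

/-! ### The finite-volume identity: mixture kinetic energy = `L²` × mixture torus average of `k₀` -/

/-- **Mixture kinetic energy as a torus average of the local bond observable**: for `L ≥ 3` (so that
`[-1,1]²` fits into the torus) and every finite mixture `(p_i, ψ_i)`,
`Σ_i p_i Re⟨ψ_i, kinOpTT' L t′ ψ_i⟩ = L² · Re Σ_i p_i · torusAvgExpect L [-1,1]² (kinBondObsTT t′) ψ_i`
(`kinOpTT' = Σ_v T_v Γ k₀`, `expect_sum_relabel_translate_fermionEmbed'`). [cite: HazraVermaRanderia2019, eq. (4)] -/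
theorem sum_mul_re_expect_kinOp_eq_sq_mul_re_torusAvg (tp : ℝ) {L : ℕ} [NeZero L] (hL : 2 < L)
    {k : ℕ} (p : Fin k → ℝ) (ψ : Fin k → Fock (Orb (FermionTorus 2 L))) :
    ∑ i, p i * (expect (kinOpTT' L tp) (ψ i)).re =
      (L : ℝ) ^ 2 * (∑ i, (p i : ℂ) * torusAvgExpect L (box 2 1) (kinBondObsTT tp) (ψ i)).re := by
  have h1 : Set.InjOn (Torus.proj (d := 2) L) ↑(box 2 1) := injOn_proj_box (by omega)
  rw [Complex.re_sum, Finset.mul_sum]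
  refine Finset.sum_congr rfl fun i _ => ?_
  rw [kinOpTT'_eq_sum_translate L tp h1, expect_sum_relabel_translate_fermionEmbed' L h1,
    ← torusAvgExpect_eq, Complex.re_ofReal_mul, ← Complex.ofReal_natCast, ← Complex.ofReal_pow,
    Complex.re_ofReal_mul]
  ring

/-! ### The leaf from a torus-limit kinetic bound -/

/-- **The single-temperature stiffness leaf from a torus-limit kinetic bound.** If every torus limit `ω` of
the canonical `(rectN n L, S^z = 0)` Gibbs states of `hubbardTorusTT' L 1 t′ U` at inverse temperature `β`
(`IsTorusLimitOfMixture` of `sectorGibbsWeightTT' β 1 t′ U n`, `sectorGibbsVectorTT' 1 t′ U n`, along any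
`Ls → ∞`; `0 ≤ n ≤ 2`) satisfies `Re ω_{[-1,1]²}(kinBondObsTT t′) ≤ 2c`, then
`ObsThermalStiffnessSeqCeilingAtBeta t′ U n β c`. Chain: compactness + `limsup`
(`eventually_re_sectorGibbsAvg_le_of_forall_torusLimit`) ⇒ `∀ ε > 0`, eventually in `L`, the mixture average of
`kinOpTT'/(2L²)` is `≤ c + ε` ⇒ the bridge's `…_of_sectorGibbsMixture_kinetic_eventually_add`.
[cite: ParamekantiTrivediRanderia1998, eq. (3) and §IV] -/
theorem ObsThermalStiffnessSeqCeilingAtBeta_of_torusLimit_kinetic_le {tp U n β : ℝ} (hβ : 0 < β)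
    (hn0 : 0 ≤ n) (hn2 : n ≤ 2) {c : ℚ}
    (hbound : ∀ (ω : InfVolFermionState 2) (Ls : ℕ → ℕ), Tendsto Ls atTop atTop →
      ω.IsTorusLimitOfMixture (sectorGibbsCount n) (fun L => sectorGibbsWeightTT' β 1 tp U n L)
        (fun L => sectorGibbsVectorTT' 1 tp U n L) Ls →
      (ω.expect (box 2 1) (kinBondObsTT tp)).re ≤ 2 * ((c : ℚ) : ℝ)) :
    ObsThermalStiffnessSeqCeilingAtBeta tp U n β c := by
  refine ObsThermalStiffnessSeqCeilingAtBeta_of_sectorGibbsMixture_kinetic_eventually_add hβ fun ε hε => ?_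
  have hev := eventually_re_sectorGibbsAvg_le_of_forall_torusLimit 1 tp U hn0 hn2 β (box 2 1)
    (kinBondObsTT tp) hbound (ε := 2 * ε) (by linarith)
  filter_upwards [hev, eventually_gt_atTop 2] with L hL hL2
  intro hL0
  rw [sum_mul_re_expect_kinOp_eq_sq_mul_re_torusAvg tp hL2]
  have hLsq : (0 : ℝ) < (L : ℝ) ^ 2 := by
    have : (0 : ℝ) < (L : ℝ) := Nat.cast_pos.2 (NeZero.pos L)
    positivity
  rw [mul_comm ((L : ℝ) ^ 2), mul_div_mul_right _ _ hLsq.ne']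
  linarith

/-- **The same, hypothesis in the reader's output shape.** A thermal certificate with objective
`Xw = −Γ_{[-1,1]² ⊆ Λ'}(kinBondObsTT t′)` (in any certificate region `Λ' ⊇ [-1,1]²`) and certified constant `−2c`,
read by `IsTorusLimitOfMixture.re_expect_ge_of_thermal_certificate_symm_TT'_of_sectorGibbs`, yields
`−2c ≤ Re ω_{Λ'}(Xw)` for every torus limit `ω`; by compatibility of `ω` this is `Re ω(k₀) ≤ 2c`, hence the leaf.
[cite: ParamekantiTrivediRanderia1998, eq. (3) and §IV] -/
theorem ObsThermalStiffnessSeqCeilingAtBeta_of_torusLimit_neg_kinetic_ge {tp U n β : ℝ} (hβ : 0 < β)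
    (hn0 : 0 ≤ n) (hn2 : n ≤ 2) {Λ' : Finset (Site 2)} (hsub : box 2 1 ⊆ Λ') {c : ℚ}
    (hcert : ∀ (ω : InfVolFermionState 2) (Ls : ℕ → ℕ), Tendsto Ls atTop atTop →
      ω.IsTorusLimitOfMixture (sectorGibbsCount n) (fun L => sectorGibbsWeightTT' β 1 tp U n L)
        (fun L => sectorGibbsVectorTT' 1 tp U n L) Ls →
      -(2 * ((c : ℚ) : ℝ)) ≤ (ω.expect Λ' (-(fermionEmbed (PolySite.incl hsub) (kinBondObsTT tp)))).re) :
    ObsThermalStiffnessSeqCeilingAtBeta tp U n β c := by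
  refine ObsThermalStiffnessSeqCeilingAtBeta_of_torusLimit_kinetic_le hβ hn0 hn2 fun ω Ls hLs hω => ?_
  have h := hcert ω Ls hLs hω
  rw [map_neg, Complex.neg_re, ω.compatible hsub (kinBondObsTT tp)] at h
  linarith

/-! ### `T_c` closures -/

namespace ThermalKTDictionaryAt

variable {tp U n : ℝ} {ρe : ℝ → ℝ} {Tc : ℝ}

/-- **ROUTE T-A from a torus-limit kinetic bound**: `Re ω(k₀) ≤ 2c` for every thermal torus limit at `β`,
and `(π/4)c < 1/β` ⇒ `Tc ≤ 1/β`. [cite: HazraVermaRanderia2019, eqs. (2)–(4)] -/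
theorem le_inv_of_torusLimit_kinetic_le (h : ThermalKTDictionaryAt tp U n ρe Tc) {β : ℝ} (hβ : 0 < β)
    (hn0 : 0 ≤ n) (hn2 : n ≤ 2) {c : ℚ}
    (hbound : ∀ (ω : InfVolFermionState 2) (Ls : ℕ → ℕ), Tendsto Ls atTop atTop →
      ω.IsTorusLimitOfMixture (sectorGibbsCount n) (fun L => sectorGibbsWeightTT' β 1 tp U n L)
        (fun L => sectorGibbsVectorTT' 1 tp U n L) Ls →
      (ω.expect (box 2 1) (kinBondObsTT tp)).re ≤ 2 * ((c : ℚ) : ℝ))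
    (hlt : Real.pi / 4 * ((c : ℚ) : ℝ) < 1 / β) : Tc ≤ 1 / β :=
  h.le_inv_of_leafAtBeta hβ (ObsThermalStiffnessSeqCeilingAtBeta_of_torusLimit_kinetic_le hβ hn0 hn2 hbound) hlt

/-- **ROUTE T-A from a thermal certificate in the reader's output shape** (`Xw = −Γk₀`, constant `−2c`):
`(π/4)c < 1/β ⇒ Tc ≤ 1/β`. [cite: HazraVermaRanderia2019, eqs. (2)–(4)] -/
theorem le_inv_of_torusLimit_neg_kinetic_ge (h : ThermalKTDictionaryAt tp U n ρe Tc) {β : ℝ} (hβ : 0 < β)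
    (hn0 : 0 ≤ n) (hn2 : n ≤ 2) {Λ' : Finset (Site 2)} (hsub : box 2 1 ⊆ Λ') {c : ℚ}
    (hcert : ∀ (ω : InfVolFermionState 2) (Ls : ℕ → ℕ), Tendsto Ls atTop atTop →
      ω.IsTorusLimitOfMixture (sectorGibbsCount n) (fun L => sectorGibbsWeightTT' β 1 tp U n L)
        (fun L => sectorGibbsVectorTT' 1 tp U n L) Ls →
      -(2 * ((c : ℚ) : ℝ)) ≤ (ω.expect Λ' (-(fermionEmbed (PolySite.incl hsub) (kinBondObsTT tp)))).re)
    (hlt : Real.pi / 4 * ((c : ℚ) : ℝ) < 1 / β) : Tc ≤ 1 / β :=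
  h.le_inv_of_leafAtBeta hβ
    (ObsThermalStiffnessSeqCeilingAtBeta_of_torusLimit_neg_kinetic_ge hβ hn0 hn2 hsub hcert) hlt

/-- **Row form at `(8, ⅞, 0)`, `β = 4`, from a torus-limit kinetic bound** («`T_KT ≤ t/4`», monotonicity-free):
if every torus limit `ω` of the canonical sector Gibbs states of `hubbardTorusTT' L 1 0 8` on
`(rectN (7/8) L, S^z = 0)` at `β = 4` has `Re ω(k₀) ≤ 2c` with `c < 0.3183098` (i.e. `⟨−k_x⟩ < 0.6366196·2`
per site fails; the `e₁`-hopping energy per site is `≥ −2c`), then `Tc ≤ 1/4`. [cite: HazraVermaRanderia2019, eqs. (2)–(4)] -/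
theorem le_quarter_of_torusLimit_kinetic_le_four (h : ThermalKTDictionaryAt 0 8 (7 / 8) ρe Tc) {c : ℚ}
    (hbound : ∀ (ω : InfVolFermionState 2) (Ls : ℕ → ℕ), Tendsto Ls atTop atTop →
      ω.IsTorusLimitOfMixture (sectorGibbsCount (7 / 8)) (fun L => sectorGibbsWeightTT' 4 1 0 8 (7 / 8) L)
        (fun L => sectorGibbsVectorTT' 1 0 8 (7 / 8) L) Ls →
      (ω.expect (box 2 1) (kinBondObsTT 0)).re ≤ 2 * ((c : ℚ) : ℝ))
    (hc : ((c : ℚ) : ℝ) < 0.3183098) : Tc ≤ 1 / 4 :=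
  h.le_quarter_of_leafAtBeta_four
    (ObsThermalStiffnessSeqCeilingAtBeta_of_torusLimit_kinetic_le (by norm_num) (by norm_num) (by norm_num) hbound)
    hc

/-- **Row form at `(8, ⅞, 0)`, `β = 4`, in the reader's output shape**: a q = 0 thermal certificate at `β = 4`
with objective `−Γ_{[-1,1]² ⊆ Λ'} k₀` (`k₀ = kinBondObsTT 0`, the nearest-neighbour `e₁`-bond kinetic word) and
certified constant `−2c`, `c < 0.3183098`, gives `Tc ≤ 1/4`. [cite: HazraVermaRanderia2019, eqs. (2)–(4)] -/
theorem le_quarter_of_torusLimit_neg_kinetic_ge_four (h : ThermalKTDictionaryAt 0 8 (7 / 8) ρe Tc)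
    {Λ' : Finset (Site 2)} (hsub : box 2 1 ⊆ Λ') {c : ℚ}
    (hcert : ∀ (ω : InfVolFermionState 2) (Ls : ℕ → ℕ), Tendsto Ls atTop atTop →
      ω.IsTorusLimitOfMixture (sectorGibbsCount (7 / 8)) (fun L => sectorGibbsWeightTT' 4 1 0 8 (7 / 8) L)
        (fun L => sectorGibbsVectorTT' 1 0 8 (7 / 8) L) Ls →
      -(2 * ((c : ℚ) : ℝ)) ≤ (ω.expect Λ' (-(fermionEmbed (PolySite.incl hsub) (kinBondObsTT 0)))).re)
    (hc : ((c : ℚ) : ℝ) < 0.3183098) : Tc ≤ 1 / 4 :=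
  h.le_quarter_of_leafAtBeta_four
    (ObsThermalStiffnessSeqCeilingAtBeta_of_torusLimit_neg_kinetic_ge (by norm_num) (by norm_num) (by norm_num)
      hsub hcert) hc

end ThermalKTDictionaryAt

end Summit.Ventures.CertifiedManyBodySolver.Observables

end
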